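import Summits.AtomisticToContinuum.BoseEinsteinCondensation.Theses.BECProbeMassFlow
import Literature.MathematicalPhysics.QuantumManyBody.PeriodicBoseGasImpurity
import Literature.MathematicalPhysics.QuantumManyBody.PeriodicClusteringFromKyFanGap
import Literature.MathematicalPhysics.QuantumManyBody.PeriodicGroundStateNondegenerateProofs
import Literature.MathematicalPhysics.QuantumManyBody.FubiniStudyAngle
import Literature.MathematicalPhysics.QuantumManyBody.PeriodicKyFanGapRayleigh
import Literature.MathematicalPhysics.QuantumManyBody.DiluteBoseGasUpperBoundLocalization
import HarnessLib

/-!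
# Anderson fidelity from ONE good pair and the clustering of near-minimisers

Helper file for the crux `BECProbeMassFlow.CloudMomentumAtom` (item stmt-AtomisticToContinuum-12310),
line `registered` (skeleton `Cruxes/CloudMomentumAtom/Lines/birth.lean`), lead c2 reshape. The line's
open stub `stub_andersonFidelityOfFinite` (every `δ`-near-minimiser `Φ` of the pinned-scatterer energy
and every `δ`-near-minimiser `Ψ` of the free periodic energy have `|⟨Ψ, Φ⟩|² ≥ 1 − ε`, at small
density, eventually in `N`, with finite infima) mixes two FIXED-`(N, L)` spectral statements with ONE
thermodynamic-limit statement. This file separates them: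

* `andersonFidelityOfFinite_of_clustering : FidelityPair → FreeClustering → ImpurityClustering → AndersonFidelityOfFinite`
  (all three as HYPOTHESES): `FidelityPair` = at every slack ONE pinned/free near-minimiser pair of
  overlap `≥ 1 − η` (the infrared content: no static orthogonality catastrophe, in near-minimiser
  language); `FreeClustering` / `ImpurityClustering` = at fixed `(N, L)`, `∀ η ∃ δ`, near-minimisers of
  the free / pinned energy pairwise overlap `≥ 1 − η`. Geometry: three overlaps `≥ 1 − η` along
  `Ψ — Ψ₀ — Φ₀ — Φ` chain to `≥ 1 − 9η` (`sq_norm_inner_ge_of_three`: Fubini–Study triangle inequality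
  of the tree, `cos 3φ = 4cos³φ − 3cos φ`); `η = ε/9`, `δ = min δ_free δ_imp`.
* `ofReal_le_sq_nnnorm_integral_of_phase` — `∫_{cell}|Ψ − e^{iθ}Ψ'|² ≤ η ⇒ |⟨Ψ, Ψ'⟩|² ≥ 1 − η`, the
  dictionary between the tree's clustering modulus and overlaps;
* `freeClustering_of_kyFanGap` — a Ky Fan gap `2E₀ < kyFanTwo v N L` with `E₀ < ⊤` gives free
  clustering in overlap form (tree: `exists_phase_integral_norm_sub_sq_le_of_kyFanGap`, all measurable `v`);
* `stub_freeClustering_integrable` — **registered stub B1, PROVED**: free clustering for every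
  admissible `v` with `∫ v(|x|)dx < ∞`, all `N ≥ 1`, `L > 0` (Reed–Simon XIII.48(a) on the torus =
  `PeriodicGroundStateNondegenerateIntegrable_holds`).

The remaining registered stubs of the reshaped skeleton (`stub_fidelityPair`,
`stub_freeKyFanGap_singular`, `stub_impurityClustering_of_gap`, `stub_impurityKyFanGap`) and the final
composition live in the skeleton; nothing here is conditional on them.
-/

noncomputable section

open MeasureTheory Filter
open scoped ENNReal NNReal ComplexConjugate BigOperators InnerProductSpace

namespace Summit.AtomisticToContinuum.BoseEinsteinCondensation.Cruxes.CloudMomentumAtom.Birth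

open Literature.MathematicalPhysics.QuantumManyBody.BoseGas
open Literature.MathematicalPhysics.QuantumManyBody

/-! ### Overlaps in a complex inner product space -/

section Abstract

variable {E : Type*} [NormedAddCommGroup E] [InnerProductSpace ℂ E]

/-- **Chaining three large overlaps.** For unit vectors `x, y, z, w` of a complex inner product space
with `|⟨x,y⟩|², |⟨y,z⟩|², |⟨z,w⟩|² ≥ 1 − η`, `0 ≤ η ≤ 1/4`: `|⟨x,w⟩|² ≥ 1 − 9η`. Proof: the
Fubini–Study angle is a pseudometric (`arccos_norm_inner_le_add_of_norm_eq_one`), each of the three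
angles is `≤ φ = arccos √(1−η) ≤ π/3`, so `|⟨x,w⟩| = cos (arccos |⟨x,w⟩|) ≥ cos 3φ = (1 − 4η)√(1 − η)`
(`cos 3φ = 4cos³φ − 3cos φ`), and `(1 − 4η)²(1 − η) ≥ 1 − 9η`. [folklore] -/
theorem sq_norm_inner_ge_of_three {x y z w : E} (hx : ‖x‖ = 1) (hy : ‖y‖ = 1) (hz : ‖z‖ = 1)
    (hw : ‖w‖ = 1) {η : ℝ} (hη0 : 0 ≤ η) (hη : η ≤ 1 / 4)
    (hxy : 1 - η ≤ ‖⟪x, y⟫_ℂ‖ ^ 2) (hyz : 1 - η ≤ ‖⟪y, z⟫_ℂ‖ ^ 2) (hzw : 1 - η ≤ ‖⟪z, w⟫_ℂ‖ ^ 2) :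
    1 - 9 * η ≤ ‖⟪x, w⟫_ℂ‖ ^ 2 := by
  set s : ℝ := Real.sqrt (1 - η) with hs
  have hs0 : 0 ≤ s := Real.sqrt_nonneg _
  have hs2 : s ^ 2 = 1 - η := Real.sq_sqrt (by linarith)
  have hs1 : s ≤ 1 := by
    rw [hs]
    calc Real.sqrt (1 - η) ≤ Real.sqrt 1 := Real.sqrt_le_sqrt (by linarith)
      _ = 1 := Real.sqrt_one
  have hshalf : 1 / 2 ≤ s := by nlinarith [hs2, hs0]
  set φ : ℝ := Real.arccos s with hφ
  -- each overlap `≥ 1 - η` is an angle `≤ φ`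
  have hang : ∀ {u u' : E}, 1 - η ≤ ‖⟪u, u'⟫_ℂ‖ ^ 2 → Real.arccos ‖⟪u, u'⟫_ℂ‖ ≤ φ := by
    intro u u' h
    refine Real.arccos_le_arccos ?_
    calc s = Real.sqrt (1 - η) := hs
      _ ≤ Real.sqrt (‖⟪u, u'⟫_ℂ‖ ^ 2) := Real.sqrt_le_sqrt h
      _ = ‖⟪u, u'⟫_ℂ‖ := Real.sqrt_sq (norm_nonneg _)
  have h3 : Real.arccos ‖⟪x, w⟫_ℂ‖ ≤ 3 * φ := by
    calc Real.arccos ‖⟪x, w⟫_ℂ‖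
        ≤ Real.arccos ‖⟪x, z⟫_ℂ‖ + Real.arccos ‖⟪z, w⟫_ℂ‖ :=
          arccos_norm_inner_le_add_of_norm_eq_one hx hz hw
      _ ≤ (Real.arccos ‖⟪x, y⟫_ℂ‖ + Real.arccos ‖⟪y, z⟫_ℂ‖) + Real.arccos ‖⟪z, w⟫_ℂ‖ := by
          gcongr
          exact arccos_norm_inner_le_add_of_norm_eq_one hx hy hz
      _ ≤ (φ + φ) + φ := by
          gcongr
          · exact hang hxy
          · exact hang hyz
          · exact hang hzw
      _ = 3 * φ := by ring
  -- `φ ≤ π / 3`, so `3φ ≤ π`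
  have hφle : φ ≤ Real.pi / 3 := by
    have h := Real.arccos_le_arccos hshalf
    rwa [← Real.cos_pi_div_three, Real.arccos_cos (by positivity)
      (by linarith [Real.pi_pos])] at h
  have h3π : 3 * φ ≤ Real.pi := by linarith
  -- `|⟨x,w⟩| = cos (arccos |⟨x,w⟩|) ≥ cos (3φ) = 4 s³ - 3 s`
  have hle1 : ‖⟪x, w⟫_ℂ‖ ≤ 1 := by simpa [hx, hw] using norm_inner_le_norm (𝕜 := ℂ) x w
  have hcos : Real.cos (3 * φ) ≤ ‖⟪x, w⟫_ℂ‖ := by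
    have h := Real.cos_le_cos_of_nonneg_of_le_pi (Real.arccos_nonneg _) h3π h3
    rwa [Real.cos_arccos (by linarith [norm_nonneg ⟪x, w⟫_ℂ]) hle1] at h
  have hcos3 : Real.cos (3 * φ) = 4 * s ^ 3 - 3 * s := by
    rw [Real.cos_three_mul, hφ, Real.cos_arccos (by linarith) hs1]
  rw [hcos3] at hcos
  -- `4 s³ - 3 s = s (1 - 4η) ≥ 0` and its square is `(1 - η)(1 - 4η)² ≥ 1 - 9η`
  have hfac : 4 * s ^ 3 - 3 * s = s * (1 - 4 * η) := by
    have : s ^ 3 = s * s ^ 2 := by ring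
    rw [this, hs2]; ring
  have hnn : 0 ≤ 4 * s ^ 3 - 3 * s := by rw [hfac]; exact mul_nonneg hs0 (by linarith)
  have hsq : (4 * s ^ 3 - 3 * s) ^ 2 ≤ ‖⟪x, w⟫_ℂ‖ ^ 2 := pow_le_pow_left₀ hnn hcos 2
  have hval : (4 * s ^ 3 - 3 * s) ^ 2 = (1 - η) * (1 - 4 * η) ^ 2 := by
    rw [hfac, mul_pow, hs2]
  rw [hval] at hsq
  have hid : (1 - η) * (1 - 4 * η) ^ 2 - (1 - 9 * η) = 8 * η ^ 2 * (3 - 2 * η) := by ring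
  have hpos : 0 ≤ 8 * η ^ 2 * (3 - 2 * η) :=
    mul_nonneg (by positivity) (by linarith)
  linarith

/-- **A near-parallel pair overlaps.** For unit vectors `u, u'` and a unit scalar `c`,
`‖u − c • u'‖² ≤ η ≤ 2` gives `|⟨u, u'⟩|² ≥ 1 − η` (`2 re (c⟨u,u'⟩) = 2 − ‖u − c•u'‖²`). [folklore] -/
theorem sq_norm_inner_ge_of_norm_sub_smul_sq_le {u u' : E} (hu : ‖u‖ = 1) (hu' : ‖u'‖ = 1)
    {c : ℂ} (hc : ‖c‖ = 1) {η : ℝ} (hη : η ≤ 2) (h : ‖u - c • u'‖ ^ 2 ≤ η) :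
    1 - η ≤ ‖⟪u, u'⟫_ℂ‖ ^ 2 := by
  have hexp : ‖u - c • u'‖ ^ 2 = 2 - 2 * (c * ⟪u, u'⟫_ℂ).re := by
    rw [@norm_sub_sq ℂ, inner_smul_right, norm_smul, hc, hu, hu']
    simp only [one_mul, one_pow, RCLike.re_to_complex]
    ring
  have hre : 1 - η / 2 ≤ (c * ⟪u, u'⟫_ℂ).re := by linarith [hexp ▸ h]
  have hnorm : (c * ⟪u, u'⟫_ℂ).re ≤ ‖⟪u, u'⟫_ℂ‖ := by
    calc (c * ⟪u, u'⟫_ℂ).re ≤ ‖c * ⟪u, u'⟫_ℂ‖ := Complex.re_le_norm _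
      _ = ‖⟪u, u'⟫_ℂ‖ := by rw [norm_mul, hc, one_mul]
  have h0 : 0 ≤ 1 - η / 2 := by linarith
  have h1 : 1 - η / 2 ≤ ‖⟪u, u'⟫_ℂ‖ := hre.trans hnorm
  nlinarith [pow_le_pow_left₀ h0 h1 2]

end Abstract

/-! ### The `L²(cell^N)` reading on periodic trial states -/

variable {N : ℕ} {L : ℝ} {v : ℝ → ℝ≥0∞}

/-- A periodic trial state is a unit vector of `L²(cell^N)`. [folklore] -/
theorem norm_toLp_trialState (Ψ : PeriodicTrialState N L) :
    ‖Ψ.memLp_two.toLp Ψ.ψ‖ = 1 := by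
  rw [Lp.norm_toLp, Ψ.eLpNorm_two_eq_one, ENNReal.toReal_one]

/-- Reading `ofReal (1 − η) ≤ (‖∫ conj Ψ · Φ‖₊)²` as the real inequality `1 − η ≤ |⟪Ψ, Φ⟫_{L²}|²`.
[folklore] -/
theorem le_sq_norm_inner_toLp_of_ofReal_le (Ψ Φ : PeriodicTrialState N L) {η : ℝ}
    (h : ENNReal.ofReal (1 - η) ≤ (‖∫ X in cellN N L, conj (Ψ.ψ X) * Φ.ψ X‖₊ : ℝ≥0∞) ^ 2) :
    1 - η ≤ ‖⟪Ψ.memLp_two.toLp Ψ.ψ, Φ.memLp_two.toLp Φ.ψ⟫_ℂ‖ ^ 2 := by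
  rw [inner_toLp_toLp_eq_integral]
  rw [ennnorm_sq_eq_ofReal] at h
  exact (ENNReal.ofReal_le_ofReal_iff (sq_nonneg _)).1 h

/-- Writing the real inequality `1 − η ≤ |⟪Ψ, Φ⟫_{L²}|²` back as `ofReal (1 − η) ≤ (‖∫ conj Ψ · Φ‖₊)²`.
[folklore] -/
theorem ofReal_le_of_le_sq_norm_inner_toLp (Ψ Φ : PeriodicTrialState N L) {η : ℝ}
    (h : 1 - η ≤ ‖⟪Ψ.memLp_two.toLp Ψ.ψ, Φ.memLp_two.toLp Φ.ψ⟫_ℂ‖ ^ 2) :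
    ENNReal.ofReal (1 - η) ≤ (‖∫ X in cellN N L, conj (Ψ.ψ X) * Φ.ψ X‖₊ : ℝ≥0∞) ^ 2 := by
  rw [inner_toLp_toLp_eq_integral] at h
  rw [ennnorm_sq_eq_ofReal]
  exact ENNReal.ofReal_le_ofReal h

/-- **Three overlaps of periodic trial states chain** (`L²(cell^N)` reading of
`sq_norm_inner_ge_of_three`): if `|⟨Ψ, Ψ₀⟩|², |⟨Ψ₀, Φ₀⟩|², |⟨Φ₀, Φ⟩|² ≥ 1 − η` with `0 ≤ η ≤ 1/4`,
then `|⟨Ψ, Φ⟩|² ≥ 1 − 9η`, all overlaps being the cell pairings `∫_{cell^N} conj · ·` in `ℝ≥0∞` form.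
[folklore] -/
theorem ofReal_le_sq_nnnorm_integral_of_three (Ψ Ψ₀ Φ₀ Φ : PeriodicTrialState N L) {η : ℝ}
    (hη0 : 0 ≤ η) (hη : η ≤ 1 / 4)
    (h1 : ENNReal.ofReal (1 - η) ≤ (‖∫ X in cellN N L, conj (Ψ.ψ X) * Ψ₀.ψ X‖₊ : ℝ≥0∞) ^ 2)
    (h2 : ENNReal.ofReal (1 - η) ≤ (‖∫ X in cellN N L, conj (Ψ₀.ψ X) * Φ₀.ψ X‖₊ : ℝ≥0∞) ^ 2)
    (h3 : ENNReal.ofReal (1 - η) ≤ (‖∫ X in cellN N L, conj (Φ₀.ψ X) * Φ.ψ X‖₊ : ℝ≥0∞) ^ 2) :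
    ENNReal.ofReal (1 - 9 * η) ≤ (‖∫ X in cellN N L, conj (Ψ.ψ X) * Φ.ψ X‖₊ : ℝ≥0∞) ^ 2 :=
  ofReal_le_of_le_sq_norm_inner_toLp Ψ Φ
    (sq_norm_inner_ge_of_three (norm_toLp_trialState Ψ) (norm_toLp_trialState Ψ₀)
      (norm_toLp_trialState Φ₀) (norm_toLp_trialState Φ) hη0 hη
      (le_sq_norm_inner_toLp_of_ofReal_le Ψ Ψ₀ h1) (le_sq_norm_inner_toLp_of_ofReal_le Ψ₀ Φ₀ h2)
      (le_sq_norm_inner_toLp_of_ofReal_le Φ₀ Φ h3))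

/-- **From the tree's clustering modulus to overlaps**: if `∫_{cell^N} |Ψ − e^{iθ}Ψ'|² ≤ η` for two
periodic trial states, then `|⟨Ψ, Ψ'⟩|² ≥ 1 − η` (in `ℝ≥0∞` form; trivial for `η ≥ 1`). [folklore] -/
theorem ofReal_le_sq_nnnorm_integral_of_phase (Ψ Ψ' : PeriodicTrialState N L) {η θ : ℝ}
    (h : ∫ X in cellN N L, ‖Ψ.ψ X - Complex.exp (θ * Complex.I) * Ψ'.ψ X‖ ^ 2 ≤ η) :
    ENNReal.ofReal (1 - η) ≤ (‖∫ X in cellN N L, conj (Ψ.ψ X) * Ψ'.ψ X‖₊ : ℝ≥0∞) ^ 2 := by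
  rcases le_or_gt 1 η with hη1 | hη1
  · rw [ENNReal.ofReal_of_nonpos (by linarith)]
    exact bot_le
  set c : ℂ := Complex.exp (θ * Complex.I) with hc
  have hc1 : ‖c‖ = 1 := Complex.norm_exp_ofReal_mul_I _
  -- the `L²` class of `Ψ - cΨ'` is `u - c • u'`, of squared norm `∫ |Ψ - cΨ'|²`
  have hF : MemLp (fun X => Ψ.ψ X - c * Ψ'.ψ X) 2 (volume.restrict (cellN N L)) :=
    Ψ.memLp_two.sub (Ψ'.memLp_two.const_mul c)
  have hcls : hF.toLp _ = Ψ.memLp_two.toLp Ψ.ψ - c • Ψ'.memLp_two.toLp Ψ'.ψ := by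
    rw [← MemLp.toLp_const_smul, ← MemLp.toLp_sub]
    rfl
  have hnorm : ‖hF.toLp _‖ ^ 2 = ∫ X in cellN N L, ‖Ψ.ψ X - c * Ψ'.ψ X‖ ^ 2 := by
    rw [@norm_sq_eq_re_inner ℂ, inner_toLp_toLp_eq_integral]
    have hI : ∫ X in cellN N L, conj (Ψ.ψ X - c * Ψ'.ψ X) * (Ψ.ψ X - c * Ψ'.ψ X) =
        ((∫ X in cellN N L, ‖Ψ.ψ X - c * Ψ'.ψ X‖ ^ 2 : ℝ) : ℂ) := by
      rw [← integral_complex_ofReal]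
      refine integral_congr_ae (Eventually.of_forall fun X => ?_)
      show conj (Ψ.ψ X - c * Ψ'.ψ X) * (Ψ.ψ X - c * Ψ'.ψ X) = ((‖Ψ.ψ X - c * Ψ'.ψ X‖ ^ 2 : ℝ) : ℂ)
      rw [Complex.conj_mul', Complex.ofReal_pow]
    rw [hI, RCLike.re_to_complex, Complex.ofReal_re]
  have hle : ‖Ψ.memLp_two.toLp Ψ.ψ - c • Ψ'.memLp_two.toLp Ψ'.ψ‖ ^ 2 ≤ η := by
    rw [← hcls, hnorm]; exact h
  exact ofReal_le_of_le_sq_norm_inner_toLp Ψ Ψ'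
    (sq_norm_inner_ge_of_norm_sub_smul_sq_le (norm_toLp_trialState Ψ) (norm_toLp_trialState Ψ')
      hc1 (by linarith) hle)

/-! ### Free clustering from a Ky Fan gap; the integrable case (stub B1) -/

/-- **Free clustering from a Ky Fan gap** (all measurable `v`, all `N`, `L`): if
`E₀ = periodicGroundStateEnergy v N L < ⊤` and `2E₀ < kyFanTwo v N L`, then for every `η > 0` there is
`δ > 0` such that any two `δ`-near-minimisers of the free periodic energy overlap, `1 − η ≤ |⟨Ψ, Ψ'⟩|²`.
The tree's `exists_phase_integral_norm_sub_sq_le_of_kyFanGap` (parallelogram law) read through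
`ofReal_le_sq_nnnorm_integral_of_phase`. [folklore] -/
theorem freeClustering_of_kyFanGap (hv : Measurable v) (hE : periodicGroundStateEnergy v N L ≠ ⊤)
    (hgap : 2 * periodicGroundStateEnergy v N L < kyFanTwo v N L) {η : ℝ} (hη : 0 < η) :
    ∃ δ : ℝ≥0∞, 0 < δ ∧ ∀ Ψ Ψ' : PeriodicTrialState N L,
      periodicEnergy v Ψ ≤ periodicGroundStateEnergy v N L + δ →
      periodicEnergy v Ψ' ≤ periodicGroundStateEnergy v N L + δ →
      ENNReal.ofReal (1 - η) ≤ (‖∫ X in cellN N L, conj (Ψ.ψ X) * Ψ'.ψ X‖₊ : ℝ≥0∞) ^ 2 := by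
  -- a positive real gap `γ` with `2E₀ + γ ≤ kyFanTwo`
  obtain ⟨γ, hγ, hγle⟩ : ∃ γ : ℝ, 0 < γ ∧
      2 * periodicGroundStateEnergy v N L + ENNReal.ofReal γ ≤ kyFanTwo v N L := by
    by_cases hK : kyFanTwo v N L = ⊤
    · exact ⟨1, one_pos, by rw [hK]; exact le_top⟩
    · set d : ℝ≥0∞ := kyFanTwo v N L - 2 * periodicGroundStateEnergy v N L with hd
      have hdtop : d ≠ ⊤ := ENNReal.sub_ne_top hK
      have hd0 : d ≠ 0 := (tsub_pos_of_lt hgap).ne'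
      refine ⟨d.toReal, ENNReal.toReal_pos hd0 hdtop, ?_⟩
      rw [ENNReal.ofReal_toReal hdtop, hd, add_tsub_cancel_of_le hgap.le]
  obtain ⟨δ, hδ, H⟩ := exists_phase_integral_norm_sub_sq_le_of_kyFanGap hv hγ hE hγle hη
  refine ⟨δ, hδ, fun Ψ Ψ' hΨ hΨ' => ?_⟩
  obtain ⟨θ, hθ⟩ := H Ψ Ψ' hΨ hΨ'
  exact ofReal_le_sq_nnnorm_integral_of_phase Ψ Ψ' hθ

/-- **Stub B1 — clustering of free near-minimisers, INTEGRABLE pair potentials (PROVED).** For every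
repulsive finite-range `v` with `∫_{ℝ³} v(|x|) dx < ∞` (every bounded admissible `v`; unbounded
integrable cores such as `r^{-5/2}·1_{r≤1}` too), all `N ≥ 1` and `L > 0`: for every `η > 0` there is a
slack `δ > 0` such that any two `δ`-near-minimisers of the free periodic energy overlap,
`1 − η ≤ |⟨Ψ, Ψ'⟩|²`. Reed–Simon XIII.48(a) on the torus (`PeriodicGroundStateNondegenerateIntegrable_holds`:
`2E₀ < kyFanTwo`) + `freeClustering_of_kyFanGap`. Registered stub of the reshaped `CloudMomentumAtom`
skeleton (lead c2). [cite: ReedSimonIV1978, §XIII.12 Thm XIII.48(a)] -/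
theorem stub_freeClustering_integrable :
    ∀ (v : ℝ → ℝ≥0∞), IsRepulsiveFiniteRange v → (∫⁻ x : Space, v ‖x‖) ≠ ⊤ →
      ∀ (N : ℕ) (L : ℝ), 1 ≤ N → 0 < L →
        ∀ η : ℝ, 0 < η → ∃ δ : ℝ≥0∞, 0 < δ ∧
          ∀ Ψ Ψ' : PeriodicTrialState N L,
            periodicEnergy v Ψ ≤ periodicGroundStateEnergy v N L + δ →
            periodicEnergy v Ψ' ≤ periodicGroundStateEnergy v N L + δ →
            ENNReal.ofReal (1 - η) ≤
              (‖∫ X in cellN N L, conj (Ψ.ψ X) * Ψ'.ψ X‖₊ : ℝ≥0∞) ^ 2 := by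
  intro v hv hint N L hN hL η hη
  have hgap := PeriodicGroundStateNondegenerateIntegrable_holds N L v hN hL hv.1 hint
  have hE : periodicGroundStateEnergy v N L ≠ ⊤ := by
    intro htop
    rw [htop, ENNReal.mul_top two_ne_zero] at hgap
    exact (not_top_lt hgap).elim
  exact freeClustering_of_kyFanGap hv.1 hE hgap hη

/-! ### The reduction -/

/-- **Anderson fidelity (finite-energy form) from one good pair and the two clusterings.**
Hypotheses: `hA` = `stub_fidelityPair` (infrared: at every slack one pinned/free near-minimiser pair
of overlap `≥ 1 − η`), `hB` = free clustering, `hC` = pinned clustering (fixed `(N, L)`: `∀ η ∃ δ`,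
near-minimisers pairwise overlap `≥ 1 − η`). Conclusion: verbatim the signature of
`stub_andersonFidelityOfFinite` (the hypothesis of the landed `cloudMomentumAtom_of_andersonFidelityOfFinite`).
Proof: `η = ε/9`, `ρ₀ = min`, intersect the eventual-`N` sets, `δ = min δ_free δ_imp`, take the good
pair `(Φ₀, Ψ₀)` at slack `δ`, and chain `Ψ — Ψ₀ — Φ₀ — Φ` (`ofReal_le_sq_nnnorm_integral_of_three`;
for `ε ≥ 1` the bound reads `0 ≤ ·`). [folklore] -/
theorem andersonFidelityOfFinite_of_clustering
    (hA : ∀ (v : ℝ → ℝ≥0∞), IsRepulsiveFiniteRange v → ∀ η : ℝ, 0 < η →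
      ∃ ρ₀ : ℝ, 0 < ρ₀ ∧ ∀ ρ : ℝ, 0 < ρ → ρ < ρ₀ → ∀ᶠ N : ℕ in atTop,
        ∀ L : ℝ, L = sideLength ρ (N + 1) →
          periodicGroundStateEnergy v N L ≠ ⊤ →
          impurityPeriodicGroundStateEnergy v N L 0 ≠ ⊤ →
          ∀ δ : ℝ≥0∞, 0 < δ →
            ∃ Φ : PeriodicTrialState N L,
              impurityPeriodicEnergy v 0 Φ ≤ impurityPeriodicGroundStateEnergy v N L 0 + δ ∧
            ∃ Ψ : PeriodicTrialState N L,
              periodicEnergy v Ψ ≤ periodicGroundStateEnergy v N L + δ ∧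
              ENNReal.ofReal (1 - η) ≤
                (‖∫ X in cellN N L, conj (Ψ.ψ X) * Φ.ψ X‖₊ : ℝ≥0∞) ^ 2)
    (hB : ∀ (v : ℝ → ℝ≥0∞), IsRepulsiveFiniteRange v →
      ∃ ρ₀ : ℝ, 0 < ρ₀ ∧ ∀ ρ : ℝ, 0 < ρ → ρ < ρ₀ → ∀ᶠ N : ℕ in atTop,
        ∀ L : ℝ, L = sideLength ρ (N + 1) →
          periodicGroundStateEnergy v N L ≠ ⊤ →
          ∀ η : ℝ, 0 < η → ∃ δ : ℝ≥0∞, 0 < δ ∧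
            ∀ Ψ Ψ' : PeriodicTrialState N L,
              periodicEnergy v Ψ ≤ periodicGroundStateEnergy v N L + δ →
              periodicEnergy v Ψ' ≤ periodicGroundStateEnergy v N L + δ →
              ENNReal.ofReal (1 - η) ≤
                (‖∫ X in cellN N L, conj (Ψ.ψ X) * Ψ'.ψ X‖₊ : ℝ≥0∞) ^ 2)
    (hC : ∀ (v : ℝ → ℝ≥0∞), IsRepulsiveFiniteRange v →
      ∃ ρ₀ : ℝ, 0 < ρ₀ ∧ ∀ ρ : ℝ, 0 < ρ → ρ < ρ₀ → ∀ᶠ N : ℕ in atTop,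
        ∀ L : ℝ, L = sideLength ρ (N + 1) →
          impurityPeriodicGroundStateEnergy v N L 0 ≠ ⊤ →
          ∀ η : ℝ, 0 < η → ∃ δ : ℝ≥0∞, 0 < δ ∧
            ∀ Φ Φ' : PeriodicTrialState N L,
              impurityPeriodicEnergy v 0 Φ ≤ impurityPeriodicGroundStateEnergy v N L 0 + δ →
              impurityPeriodicEnergy v 0 Φ' ≤ impurityPeriodicGroundStateEnergy v N L 0 + δ →
              ENNReal.ofReal (1 - η) ≤
                (‖∫ X in cellN N L, conj (Φ.ψ X) * Φ'.ψ X‖₊ : ℝ≥0∞) ^ 2) :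
    ∀ (v : ℝ → ℝ≥0∞), IsRepulsiveFiniteRange v → ∀ ε : ℝ, 0 < ε →
      ∃ ρ₀ : ℝ, 0 < ρ₀ ∧ ∀ ρ : ℝ, 0 < ρ → ρ < ρ₀ → ∀ᶠ N : ℕ in atTop,
        ∀ L : ℝ, L = sideLength ρ (N + 1) →
          periodicGroundStateEnergy v N L ≠ ⊤ →
          impurityPeriodicGroundStateEnergy v N L 0 ≠ ⊤ →
          ∃ δ : ℝ≥0∞, 0 < δ ∧
            ∀ Φ : PeriodicTrialState N L,
              impurityPeriodicEnergy v 0 Φ ≤ impurityPeriodicGroundStateEnergy v N L 0 + δ →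
            ∀ Ψ : PeriodicTrialState N L,
              periodicEnergy v Ψ ≤ periodicGroundStateEnergy v N L + δ →
              ENNReal.ofReal (1 - ε) ≤
                (‖∫ X in cellN N L, conj (Ψ.ψ X) * Φ.ψ X‖₊ : ℝ≥0∞) ^ 2 := by
  intro v hv ε hε
  have hη : (0 : ℝ) < ε / 9 := by positivity
  obtain ⟨ρA, hρA, HA⟩ := hA v hv (ε / 9) hη
  obtain ⟨ρB, hρB, HB⟩ := hB v hv
  obtain ⟨ρC, hρC, HC⟩ := hC v hv
  refine ⟨min ρA (min ρB ρC), lt_min hρA (lt_min hρB hρC), fun ρ hρ hρlt => ?_⟩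
  have hρA' : ρ < ρA := hρlt.trans_le (min_le_left _ _)
  have hρB' : ρ < ρB := hρlt.trans_le ((min_le_right _ _).trans (min_le_left _ _))
  have hρC' : ρ < ρC := hρlt.trans_le ((min_le_right _ _).trans (min_le_right _ _))
  filter_upwards [HA ρ hρ hρA', HB ρ hρ hρB', HC ρ hρ hρC'] with N hNA hNB hNC
  intro L hL hE hEimp
  obtain ⟨δB, hδB, KB⟩ := hNB L hL hE (ε / 9) hη
  obtain ⟨δC, hδC, KC⟩ := hNC L hL hEimp (ε / 9) hη
  refine ⟨min δB δC, lt_min hδB hδC, fun Φ hΦ Ψ hΨ => ?_⟩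
  -- the good pair at slack `min δB δC`
  obtain ⟨Φ₀, hΦ₀, Ψ₀, hΨ₀, hpair⟩ := hNA L hL hE hEimp (min δB δC) (lt_min hδB hδC)
  -- for `ε ≥ 1` there is nothing to prove
  rcases le_or_gt 1 ε with hε1 | hε1
  · rw [ENNReal.ofReal_of_nonpos (by linarith)]
    exact bot_le
  have h1 : ENNReal.ofReal (1 - ε / 9) ≤
      (‖∫ X in cellN N L, conj (Ψ.ψ X) * Ψ₀.ψ X‖₊ : ℝ≥0∞) ^ 2 :=
    KB Ψ Ψ₀ (hΨ.trans (add_le_add le_rfl (min_le_left _ _)))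
      (hΨ₀.trans (add_le_add le_rfl (min_le_left _ _)))
  have h3 : ENNReal.ofReal (1 - ε / 9) ≤
      (‖∫ X in cellN N L, conj (Φ₀.ψ X) * Φ.ψ X‖₊ : ℝ≥0∞) ^ 2 :=
    KC Φ₀ Φ (hΦ₀.trans (add_le_add le_rfl (min_le_right _ _)))
      (hΦ.trans (add_le_add le_rfl (min_le_right _ _)))
  have key := ofReal_le_sq_nnnorm_integral_of_three Ψ Ψ₀ Φ₀ Φ hη.le (by linarith) h1 hpair h3
  have h9 : 1 - 9 * (ε / 9) = 1 - ε := by ring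
  rwa [h9] at key

end Summit.AtomisticToContinuum.BoseEinsteinCondensation.Cruxes.CloudMomentumAtom.Birth

end
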